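import Summits.BirchSwinnertonDyer.BirchSwinnertonDyer.Theorems.WildThreeRankOneBSDpOfJetchevMaxSockets
import Summits.BirchSwinnertonDyer.BirchSwinnertonDyer.Theses.KatoDescentPotSupersingular
import HarnessLib

/-!
# Single-carrier JET rows of W-ALL row 2·3@3: the rank-zero input is ONLY the LOWER half of the twist — K9's crux
# `WildLowerHalfRankZero` (L₀, stmt-BirchSwinnertonDyer-19195) BY NAME — the twist's upper half being Kato's
# Tamagawa-exact bound on the 3-adic tower (route-free class theorem; cell `bsd-wall`, D-0131 (3) M-UTD, seat
# `bsd-wall-utd-p3` gen 3; `--supports stmt-BirchSwinnertonDyer-20760`, helper)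

Sequel of `WildThreeRankOneBSDpOfJetchevMaxOfLiterature.lean` (p570933) and `…Sockets.lean` (p573098): there the
coprime ∪ single-carrier JET-exact sub-class of the onto wild rank-one row at `3` was shown to satisfy
`BSD₃(E) ⟺ BSD₃(E^{d_K})` from named print. Here the rank-zero side is split into halves, as bsd-potss-kmc g20 did
for SOED's rows (`AdditiveWildRankOneOfRouteTexts`, p563986): the twist's UPPER half (`ord₃ #Ш(E^D) ≤ ord₃ Ш_an(E^D)`)
is Kato's Tamagawa-exact bound at an additive potentially good prime on the tower-onto rows (kmc g20's
`missingUpperBoundAt_twist_of_towerSurj_of_katoTam`, p556810, on the named fact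
`Kato2004.rankZero_padicValNat_sha_add_padicValNat_tamagawa_le_of_additive_potGood_of_imageContainsSL2`), so the ONLY
research input left on these rows is the twist's LOWER half — K9's crux L₀ `WildLowerHalfRankZero` (route
`KatoDescentPotSupersingular`, item 19195: `r_an = 0 ∧ ClassO6 W 3 ⟹ Typed.MissingLowerBoundAt W 3`), consumed BY NAME.

* `bsdp_three_of_singleCarrier_of_literature_of_katoTam_of_wildLowerHalfRankZero` — {(PT), (F1), (3.7)} + {GZ,
  Kolyvagin, GZK, modularity, GZ86 I.(7.3)} + Kato A161″ (all named) + **L₀** (K9 crux, hypothesis) ⟹ `BSDp W 3` on a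
  coprime ∪ single-carrier JET-exact Heegner datum of the onto wild rank-one row at `3` with the 3-adic tower.

HONEST FRAMING: CONDITIONAL on the named facts and on K9's open crux L₀ (hypothesis); per datum; closes no item and no
class; «beyond-print theorem»: NO. Compared with p570933 §2 the hypothesis `WAllExclAddWildRankZero` (full `BSD₃` of
every rank-zero wild row) is replaced by its LOWER half on ClassO6 (L₀) plus one more named fact (Kato). BSD is not
proved for any curve by this file. No definition, no named fact, no `sorry`.
References: [Kato2004Asterisque] Thm. 14.5 (3), (12.5.2); [Jetchev2008] Thm. 1.4, Cor. 1.5; [JetchevSkinnerWan2017]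
§7.4.1; [GrossZagier1986] I.(6.3), I.(7.3).
-/

noncomputable section

open scoped Classical

set_option linter.dupNamespace false
set_option autoImplicit false

namespace Summit.BirchSwinnertonDyer.BirchSwinnertonDyer.Theorems.SchneiderFree.Exact

open WeierstrassCurve NumberField IsDedekindDomain Field
  Literature.NumberTheory.EllipticCurves
  Literature.NumberTheory.EllipticCurves.ModularForms
  Literature.NumberTheory.EllipticCurves.Rank1Residual
  Literature.NumberTheory.EllipticCurves.Rank1Residual.Typed
  Literature.NumberTheory.EllipticCurves.KrizLi2019
  Literature.NumberTheory.GaloisCohomology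
  Summit.BirchSwinnertonDyer.Rank1Residual
  Summit.BirchSwinnertonDyer.Rank1Residual.Additive
  Summit.BirchSwinnertonDyer.Rank1Residual.X11b
  Summit.BirchSwinnertonDyer.Rank1Residual.X11b.Three
  Summit.BirchSwinnertonDyer.BirchSwinnertonDyer.Theorems.UniversalToricDescentWaldspurgerFlat
  Summit.BirchSwinnertonDyer.BirchSwinnertonDyer.Theses.KatoDescentPotSupersingular

/-- **Single-carrier JET sub-leaf ⟸ named print + Kato + K9's L₀ only.** For `E` (globally minimal `W`) on
`ClassO6 W 3` with `r_an = 1`, `ρ_{E,3^n}` onto for every `n`, ONE Heegner datum `(K, Dt, H, ι, P)` at level `N_E`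
(odd `d_K`, Heegner hypothesis, `L(E^{d_K},1) ≠ 0`, `P = y_K`) with JET-exact index carried by ONE prime `q₀ ∣ N_E`:
(PT) ∀ `K`, (F1), (3.7), Gross–Zagier, Kolyvagin, GZK, modularity, GZ86 I.(7.3), Kato's A161″
(`Kato2004.rankZero_padicValNat_sha_add_padicValNat_tamagawa_le_of_additive_potGood_of_imageContainsSL2`) — all named,
hypotheses — and K9's crux L₀ `WildLowerHalfRankZero` (hypothesis) give `BSDp W 3`. Proof: a minimal model `Wd` of
`E^{d_K}` is an O6 row with the same `j` and the same tower (`classO6_twist_of_heegner`), of analytic rank `0`; its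
LOWER half is L₀ at `Wd`, its UPPER half is kmc g20's `missingUpperBoundAt_twist_of_towerSurj_of_katoTam`; so
`BSDp Wd 3` (`Typed.bsdp_of_missingPPartAt`), and `bsdp_iff_partner_bsdp_of_singleCarrier_of_literature` (p573098)
transfers it to `W`. [cite: Kato2004Asterisque, Thm. 14.5 (3) (p. 236) and (12.5.2) (p. 222)]
[cite: Jetchev2008, Thm. 1.4, Cor. 1.5 (arXiv:math/0703431 p. 3)] [cite: JetchevSkinnerWan2017, §7.4.1 (arXiv:1512.06894 p. 30)] -/
theorem bsdp_three_of_singleCarrier_of_literature_of_katoTam_of_wildLowerHalfRankZero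
    (hPT : ∀ (K : Type) [Field K] [NumberField K], poitouTate_selmerStructure_duality_conj K)
    (hF1 : Gross1991_heegnerPoint_sub_ratTorsion_mem_E0)
    (h372 : GrossLMS1991.prop37_2_frobeniusCongruence)
    (hGZ : ∀ (N : ℕ) [NeZero N] (W : WeierstrassCurve ℚ) (K : Type) [Field K] [NumberField K],
      gross_zagier N W K)
    (hKo : ∀ (N : ℕ) [NeZero N] (W : WeierstrassCurve ℚ) (K : Type) [Field K] [NumberField K],
      kolyvagin N W K)
    (hGZK : rank_eq_analyticRank_of_analyticRank_le_one) (hmod : hasEntireLFunction_rat)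
    (hGZ73 : GrossZagier1986_thm_I_7_3)
    (hKatoT : Kato2004.rankZero_padicValNat_sha_add_padicValNat_tamagawa_le_of_additive_potGood_of_imageContainsSL2)
    (hL0 : WildLowerHalfRankZero)
    (W : WeierstrassCurve ℚ) [W.IsElliptic] [W.IsGloballyMinimal] [NeZero (W.conductorNorm ℤ)]
    (hO6 : ClassO6 W 3) (hρ : ∀ n : ℕ, W.HasSurjectiveModNGaloisRep (3 ^ n : ℕ)) (hr : W.analyticRank = 1)
    (K : Type) [Field K] [NumberField K]
    (Dt : ModularParametrizationData W (W.conductorNorm ℤ))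
    (H : HeegnerDatum (W.conductorNorm ℤ) (NumberField.discr K)) (ι : K →+* ℂ)
    (P : (W.baseChange K).toAffine.Point)
    (hK : IsImaginaryQuadratic K) (hodd : Odd (NumberField.discr K))
    (hHH : SatisfiesHeegnerHypothesis (W.conductorNorm ℤ) K)
    (hLd : (W.quadraticTwist (NumberField.discr K : ℚ)).entireLFunction 1 ≠ 0)
    (hP : WeierstrassCurve.Affine.Point.map ι.toRatAlgHom P = heegnerPointComplex Dt H)
    (hI : padicValNat 3 (AddSubgroup.zmultiples P).index =
      padicValNat 3 W.tamagawaProduct + padicValNat 3 Dt.c.natAbs)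
    {q₀ : ℕ} [Fact q₀.Prime] (hq₀ : q₀ ∣ W.conductorNorm ℤ)
    (hcar : padicValNat 3 W.tamagawaProduct + padicValNat 3 Dt.c.natAbs ≤
      padicValNat 3 ((W.baseChange ℚ_[q₀]).localTamagawaNumber ℤ_[q₀])) :
    BSDp W 3 := by
  haveI : Fact (3 : ℕ).Prime := ⟨by norm_num⟩
  -- a globally minimal model `Wd` of the twist: an O6 row, rank zero, same tower
  have hD0 : (NumberField.discr K : ℚ) ≠ 0 := by exact_mod_cast NumberField.discr_ne_zero K
  haveI : (W.quadraticTwist (NumberField.discr K : ℚ)).IsElliptic := W.isElliptic_quadraticTwist hD0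
  obtain ⟨Cd, hCd⟩ := hasGlobalMinimalModel_rat_holds (W.quadraticTwist (NumberField.discr K : ℚ))
  haveI : (Cd • W.quadraticTwist (NumberField.discr K : ℚ)).IsGloballyMinimal := hCd
  set Wd := Cd • W.quadraticTwist (NumberField.discr K : ℚ) with hWd
  obtain ⟨hO6d, -⟩ := classO6_twist_of_heegner W hO6 K hK hHH hodd Wd Cd rfl
  have hLd1 : Wd.entireLFunction 1 ≠ 0 := by rw [hWd, entireLFunction_smul]; exact hLd
  have hrd : Wd.analyticRank = 0 := analyticRank_eq_zero_of_entireLFunction_one_ne_zero Wd hLd1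
  -- LOWER half of the twist: K9's L₀ by name; UPPER half: Kato's Tamagawa-exact bound on the tower (kmc g20)
  have hlow : MissingLowerBoundAt Wd 3 := hL0 Wd hrd hO6d
  have hupd : MissingUpperBoundAt Wd 3 :=
    missingUpperBoundAt_twist_of_towerSurj_of_katoTam 3 (by decide) hKatoT hGZK hmod W hO6.2.1
      hO6.padicValRat_j_nonneg hρ rfl K hK hHH Wd ⟨Cd, rfl⟩ hLd
  have hWdBSD : BSDp Wd 3 :=
    bsdp_of_missingPPartAt Wd 3 hGZK (by rw [hrd]; exact zero_le_one) (missingPPartAt_of_lower_of_upper Wd 3 hlow hupd)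
  -- transfer to `W` on the single-carrier JET-exact datum
  exact (bsdp_iff_partner_bsdp_of_singleCarrier_of_literature hPT hF1 h372 hGZ hKo hGZK hmod hGZ73 W hO6 hρ hr K Dt H
    ι P Wd hK hodd hHH hLd hP ⟨Cd, rfl⟩ hI hq₀ hcar).mpr hWdBSD

end Summit.BirchSwinnertonDyer.BirchSwinnertonDyer.Theorems.SchneiderFree.Exact

end
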